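import Summits.QuantumFields.GaugeBoot.PeriodicBoxSiteFrames
import HarnessLib

/-!
# Which periodic boxes `ℤ^d / Γ` carry a tilted diagonal frame: classification
# (gauge-boot, L3 structural supplement, part 2 of 2)

HONEST FRAMING (cell `pub-gaugeboot`, page 1 of every file): the venture produces certified bounds
on lattice expectations at stated coupling, gauge group, dimension and torus size; NOT a mass gap,
NOT a continuum limit, NOT a string tension; NOT Yang–Mills-summit-bearing (barriers
`FixedCouplingUltralocality`, `PerturbativeInvisibility`). This module is a small STRUCTURAL result
about the lane's reflection mechanisms; it bounds no expectation and discharges nothing else.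

Continuation of `PeriodicBoxSiteFrames.lean` (periodic boxes `ℤ^d / Γ`, marked translations
`PeriodicBox.unit Γ m = [e_m]`, site frames classified) — here the diagonal family.

**Theorem (`PeriodicBox.exists_isTiltedFrame_iff`).** `ℤ^d / Γ` carries a tilted diagonal frame in
the coordinate plane `(i, j)` with half period `P` (`IsTiltedFrame`, `TiltedRPGeometry.lean`: the
structure behind DIAGONAL reflection positivity in `x_i = x_j`, Kazakov–Zheng's third family) if and
only if `i ≠ j`, `P ≥ 2`, `P (e_i - e_j) ∈ Γ` and `Γ ⊆ {x : 2P ∣ x_i - x_j}` — i.e.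
`Γ = (Γ ∩ {x_i = x_j}) ⊕ ℤ · P (e_i - e_j)`: the box has an honest period `P (e_i - e_j)` ALONG THE
ANTI-DIAGONAL of the plane, all other periods lying in the mirror hyperplane `x_i = x_j`. So
Fröhlich–Israel–Lieb–Simon's "periodic box with sides at 45°" (J. Stat. Phys. 22 (1980) §3;
`isTiltedFrame_tiltedBox`: `Γ(M_u, M_v, L)`, `P = M_v`) is not one example but the general case,
and the cubic torus never qualifies (`not_isTiltedFrame_cubicTorus`). The frame is then unique and
explicit (`IsTiltedFrame.eq_mirror_diagHeight`): the swap `[x] ↦ [x ∘ (i j)]`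
(`PeriodicBox.mirror`) and the height `[x] ↦ x_i - x_j mod 2P` (`PeriodicBox.diagHeight`).

Necessity is the torsion arithmetic of `TiltedFrameNoGo.lean` (`P • (e_i - e_j) = 0`) plus the
identification of the height with the diagonal coordinate (`diagHeight_mk_of_isTiltedFrame`);
sufficiency is the computation `x - x ∘ (i j) = (x_i - x_j)(e_i - e_j)` of `TiltedBox.lean`
(`swapHom_eq_sub`), now for every `Γ`.

Read together with the two no-gos (`TiltedFrameNoGo.lean`: a tilted frame in `(i, j)` excludes site
frames along `i`, `j`; `TiltedFrameRigidity.lean`: tilted frames in two planes sharing an axis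
exclude each other) the two classification theorems describe the frame patterns of periodic boxes:
site frames along a set `K` of axes of even period, tilted frames on pairwise DISJOINT coordinate
planes avoiding `K` (two disjoint planes at once are realised by the doubly tilted box of
`DoublyTiltedBox.lean`, `d ≥ 4`).

What this module does NOT say: it is about FRAMES, not about reflection positivity itself
(RP-level failures on the cubic torus: `DiagonalRPTorusNegative.lean` ff.).

References: J. Fröhlich, R. Israel, E. H. Lieb, B. Simon, Comm. Math. Phys. 62 (1978) 1, Thm. 2.1,
and J. Stat. Phys. 22 (1980) 297, §3 (Model 3.1); K. Osterwalder, E. Seiler, Ann. Phys. 110 (1978)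
440, §2; M. Biskup, in LNM 1970 (2009) §5 (torus reflections); V. Kazakov, Z. Zheng,
arXiv:2203.11360 §3.1.
-/

open QuotientAddGroup

namespace Summit.QuantumFields.GaugeBoot

namespace TiltedRP

/-! ## A coordinate identity on `ℤ^d` -/

section Coordinates

variable (d : ℕ)

/-- `x ∘ (i j) = x - (x_i - x_j)(e_i - e_j)` (`i ≠ j`). -/
theorem swapHom_eq_sub {i j : Fin d} (hij : i ≠ j) (x : Fin d → ℤ) :
    swapHom d i j x =
      x - (x i - x j) • (Pi.single i (1 : ℤ) - Pi.single j (1 : ℤ) : Fin d → ℤ) := by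
  funext m
  simp only [swapHom_apply, Pi.sub_apply, Pi.smul_apply, smul_eq_mul]
  by_cases hmi : m = i
  · rw [hmi, Equiv.swap_apply_left, Pi.single_eq_same, Pi.single_eq_of_ne hij]
    ring
  · by_cases hmj : m = j
    · rw [hmj, Equiv.swap_apply_right, Pi.single_eq_same, Pi.single_eq_of_ne (Ne.symm hij)]
      ring
    · rw [Equiv.swap_apply_of_ne_of_ne hmi hmj, Pi.single_eq_of_ne hmi, Pi.single_eq_of_ne hmj]
      ring

end Coordinates

namespace PeriodicBox

variable {d : ℕ}

/-! ## Tilted diagonal frames on a periodic box -/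

section Tilted

variable {Γ : AddSubgroup (Fin d → ℤ)} {i j : Fin d} {P : ℕ}

/-- **The height of a tilted diagonal frame on a periodic box is the diagonal coordinate**:
`v [x] = x_i - x_j mod 2P`. -/
theorem diagHeight_mk_of_isTiltedFrame {θ : (Fin d → ℤ) ⧸ Γ →+ (Fin d → ℤ) ⧸ Γ}
    {v : (Fin d → ℤ) ⧸ Γ →+ ZMod (2 * P)} (hF : IsTiltedFrame (unit Γ) i j θ P v)
    (x : Fin d → ℤ) : v (x : (Fin d → ℤ) ⧸ Γ) = ((x i - x j : ℤ) : ZMod (2 * P)) := by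
  have key : v.comp (QuotientAddGroup.mk' Γ) = diffHom d i j P := by
    refine AddMonoidHom.functions_ext' _ _ _ fun m => AddMonoidHom.ext_int ?_
    simp only [diffHom, AddMonoidHom.coe_comp, Function.comp_apply, AddMonoidHom.single_apply,
      QuotientAddGroup.mk'_apply, AddMonoidHom.sub_apply, Pi.evalAddMonoidHom_apply,
      Int.coe_castAddHom]
    by_cases hmi : m = i
    · subst hmi
      rw [Pi.single_eq_same, Pi.single_eq_of_ne hF.ne.symm, sub_zero, Int.cast_one]
      exact hF.height_left
    · by_cases hmj : m = j
      · subst hmj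
        rw [Pi.single_eq_same, Pi.single_eq_of_ne hF.ne, zero_sub, Int.cast_neg, Int.cast_one]
        exact hF.height_right
      · rw [Pi.single_eq_of_ne (Ne.symm hmi), Pi.single_eq_of_ne (Ne.symm hmj), sub_zero,
          Int.cast_zero]
        exact hF.height_other m hmi hmj
  have := DFunLike.congr_fun key x
  simpa [diffHom] using this

/-- Necessity, first half: **every period `γ` has `2P ∣ γ_i - γ_j`.** -/
theorem dvd_diff_of_isTiltedFrame {θ : (Fin d → ℤ) ⧸ Γ →+ (Fin d → ℤ) ⧸ Γ}
    {v : (Fin d → ℤ) ⧸ Γ →+ ZMod (2 * P)} (hF : IsTiltedFrame (unit Γ) i j θ P v) {γ : Fin d → ℤ}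
    (hγ : γ ∈ Γ) : ((2 * P : ℕ) : ℤ) ∣ γ i - γ j := by
  have h0 : v (γ : (Fin d → ℤ) ⧸ Γ) = 0 := by
    rw [(QuotientAddGroup.eq_zero_iff γ).2 hγ, map_zero]
  rw [diagHeight_mk_of_isTiltedFrame hF] at h0
  exact (ZMod.intCast_zmod_eq_zero_iff_dvd _ _).1 h0

/-- Necessity, second half: **`P (e_i - e_j)` is a period** (the box is periodic along the
anti-diagonal of the plane with period `P`). -/
theorem nsmul_diff_mem_of_isTiltedFrame {θ : (Fin d → ℤ) ⧸ Γ →+ (Fin d → ℤ) ⧸ Γ}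
    {v : (Fin d → ℤ) ⧸ Γ →+ ZMod (2 * P)} (hF : IsTiltedFrame (unit Γ) i j θ P v) :
    P • (Pi.single i (1 : ℤ) - Pi.single j (1 : ℤ) : Fin d → ℤ) ∈ Γ := by
  rw [← QuotientAddGroup.eq_zero_iff, QuotientAddGroup.mk_nsmul, QuotientAddGroup.mk_sub]
  exact hF.nsmul_e_sub_e_eq_zero

/-- Sufficiency, step 1: under the two conditions `Γ` is swap invariant
(`γ - γ ∘ (i j) = (γ_i - γ_j)(e_i - e_j)`, a multiple of the period `P (e_i - e_j)`). -/
theorem le_comap_swapHom (hij : i ≠ j)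
    (hmem : P • (Pi.single i (1 : ℤ) - Pi.single j (1 : ℤ) : Fin d → ℤ) ∈ Γ)
    (hdiv : ∀ γ ∈ Γ, ((2 * P : ℕ) : ℤ) ∣ γ i - γ j) : Γ ≤ Γ.comap (swapHom d i j) := by
  intro γ hγ
  rw [AddSubgroup.mem_comap, swapHom_eq_sub d hij]
  obtain ⟨c, hc⟩ := hdiv γ hγ
  refine Γ.sub_mem hγ ?_
  rw [hc, show ((2 * P : ℕ) : ℤ) * c = (P : ℤ) * (2 * c) by push_cast; ring]
  exact mul_zsmul_mem hmem _

/-- **The diagonal mirror of the box in the plane `(i, j)`**: `[x] ↦ [x ∘ (i j)]` (defined when `Γ`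
is swap invariant). -/
def mirror (hΓ : Γ ≤ Γ.comap (swapHom d i j)) : (Fin d → ℤ) ⧸ Γ →+ (Fin d → ℤ) ⧸ Γ :=
  QuotientAddGroup.map Γ Γ (swapHom d i j) hΓ

/-- **The diagonal height `[x] ↦ x_i - x_j mod 2P` of the box** (defined when
`Γ ⊆ {2P ∣ x_i - x_j}`). -/
def diagHeight (P : ℕ) (hdiv : ∀ γ ∈ Γ, ((2 * P : ℕ) : ℤ) ∣ γ i - γ j) :
    (Fin d → ℤ) ⧸ Γ →+ ZMod (2 * P) :=
  QuotientAddGroup.lift Γ (diffHom d i j P) (fun γ hγ => by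
    rw [AddMonoidHom.mem_ker]
    simpa [diffHom] using (ZMod.intCast_zmod_eq_zero_iff_dvd _ _).2 (hdiv γ hγ))

/-- The mirror on classes. -/
theorem mirror_mk (hΓ : Γ ≤ Γ.comap (swapHom d i j)) (x : Fin d → ℤ) :
    mirror hΓ (x : (Fin d → ℤ) ⧸ Γ) = ((swapHom d i j x : Fin d → ℤ) : (Fin d → ℤ) ⧸ Γ) := rfl

/-- The diagonal height on classes. -/
theorem diagHeight_mk (hdiv : ∀ γ ∈ Γ, ((2 * P : ℕ) : ℤ) ∣ γ i - γ j) (x : Fin d → ℤ) :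
    diagHeight P hdiv (x : (Fin d → ℤ) ⧸ Γ) = ((x i - x j : ℤ) : ZMod (2 * P)) := by
  show diffHom d i j P x = _
  simp [diffHom]

/-- **Sufficiency: the box carries the tilted diagonal frame `(mirror, diagHeight)` in the plane
`(i, j)`** as soon as `i ≠ j`, `P ≥ 2`, `P (e_i - e_j) ∈ Γ` and `Γ ⊆ {2P ∣ x_i - x_j}`. The layers
`x_i - x_j ≡ 0, P (mod 2P)` are pointwise fixed because `x - x ∘ (i j) = (x_i - x_j)(e_i - e_j)` is a
multiple of the period `P (e_i - e_j)` when `P ∣ x_i - x_j` — the computation of `TiltedBox.lean`,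
now for every `Γ`. -/
theorem isTiltedFrame (hij : i ≠ j) (hP : 2 ≤ P)
    (hmem : P • (Pi.single i (1 : ℤ) - Pi.single j (1 : ℤ) : Fin d → ℤ) ∈ Γ)
    (hdiv : ∀ γ ∈ Γ, ((2 * P : ℕ) : ℤ) ∣ γ i - γ j) :
    IsTiltedFrame (unit Γ) i j (mirror (le_comap_swapHom hij hmem hdiv)) P (diagHeight P hdiv) where
  ne := hij
  two_le := hP
  map_e k := by rw [unit, unit, mirror_mk, swapHom_single]
  invol q := by
    induction q using QuotientAddGroup.induction_on with
    | H x =>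
      rw [mirror_mk, mirror_mk]
      congr 1
      funext m
      simp [Equiv.swap_apply_self]
  height_left := by
    rw [unit, diagHeight_mk, Pi.single_eq_same, Pi.single_eq_of_ne hij.symm, sub_zero, Int.cast_one]
  height_right := by
    rw [unit, diagHeight_mk, Pi.single_eq_same, Pi.single_eq_of_ne hij, zero_sub, Int.cast_neg,
      Int.cast_one]
  height_other k hki hkj := by
    rw [unit, diagHeight_mk, Pi.single_eq_of_ne (Ne.symm hki), Pi.single_eq_of_ne (Ne.symm hkj),
      sub_zero, Int.cast_zero]
  height_map q := by
    induction q using QuotientAddGroup.induction_on with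
    | H x =>
      rw [mirror_mk, diagHeight_mk, diagHeight_mk]
      simp only [swapHom_apply, Equiv.swap_apply_left, Equiv.swap_apply_right]
      push_cast
      ring
  fix_of_layer q hq := by
    induction q using QuotientAddGroup.induction_on with
    | H x =>
      rw [diagHeight_mk] at hq
      rw [mirror_mk, QuotientAddGroup.eq, swapHom_eq_sub d hij, neg_sub, sub_add_cancel]
      -- `P ∣ x_i - x_j`
      have hdvd : (P : ℤ) ∣ x i - x j := by
        rcases hq with h | h
        · have h' := (ZMod.intCast_zmod_eq_zero_iff_dvd _ _).1 h
          exact (Dvd.intro 2 (by push_cast; ring) : (P : ℤ) ∣ ((2 * P : ℕ) : ℤ)).trans h'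
        · have h' : (((x i - x j - P : ℤ)) : ZMod (2 * P)) = 0 := by
            push_cast at h ⊢
            rw [h, sub_self]
          have h'' := (ZMod.intCast_zmod_eq_zero_iff_dvd _ _).1 h'
          have h3 : (P : ℤ) ∣ x i - x j - P :=
            (Dvd.intro 2 (by push_cast; ring) : (P : ℤ) ∣ ((2 * P : ℕ) : ℤ)).trans h''
          simpa using h3.add (dvd_refl (P : ℤ))
      obtain ⟨c, hc⟩ := hdvd
      rw [hc]
      exact mul_zsmul_mem hmem c

/-- **CLASSIFICATION OF THE PERIODIC BOXES CARRYING A TILTED DIAGONAL FRAME.** `ℤ^d / Γ` carries a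
tilted diagonal frame in the coordinate plane `(i, j)` with half period `P` — for some mirror and
some height — if and only if `i ≠ j`, `P ≥ 2`, `P (e_i - e_j) ∈ Γ` and every period `γ` has
`2P ∣ γ_i - γ_j` (`Γ = (Γ ∩ {x_i = x_j}) ⊕ ℤ · P (e_i - e_j)`): the box must be HONESTLY PERIODIC
ALONG THE ANTI-DIAGONAL `e_i - e_j` with period `P`, all other periods lying in the mirror hyperplane
`x_i = x_j` — Fröhlich–Israel–Lieb–Simon's box with sides at 45° (`isTiltedFrame_tiltedBox`:
`Γ(M_u, M_v, L)`, `P = M_v`) is the general case, the cubic torus never qualifies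
(`not_isTiltedFrame_cubicTorus`). -/
theorem exists_isTiltedFrame_iff (Γ : AddSubgroup (Fin d → ℤ)) (i j : Fin d) (P : ℕ) :
    (∃ (θ : (Fin d → ℤ) ⧸ Γ →+ (Fin d → ℤ) ⧸ Γ) (v : (Fin d → ℤ) ⧸ Γ →+ ZMod (2 * P)),
        IsTiltedFrame (unit Γ) i j θ P v) ↔
      i ≠ j ∧ 2 ≤ P ∧ P • (Pi.single i (1 : ℤ) - Pi.single j (1 : ℤ) : Fin d → ℤ) ∈ Γ ∧
        ∀ γ ∈ Γ, ((2 * P : ℕ) : ℤ) ∣ γ i - γ j := by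
  constructor
  · rintro ⟨θ, v, hF⟩
    exact ⟨hF.ne, hF.two_le, nsmul_diff_mem_of_isTiltedFrame hF,
      fun γ hγ => dvd_diff_of_isTiltedFrame hF hγ⟩
  · rintro ⟨hij, hP, hmem, hdiv⟩
    exact ⟨_, _, isTiltedFrame hij hP hmem hdiv⟩

/-- **Uniqueness, explicitly**: every tilted diagonal frame on a periodic box IS the Fröhlich–
Israel–Lieb–Simon one — its mirror is the swap `[x] ↦ [x ∘ (i j)]` and its height is
`[x] ↦ x_i - x_j mod 2P`. -/
theorem _root_.Summit.QuantumFields.GaugeBoot.TiltedRP.IsTiltedFrame.eq_mirror_diagHeight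
    {θ : (Fin d → ℤ) ⧸ Γ →+ (Fin d → ℤ) ⧸ Γ} {v : (Fin d → ℤ) ⧸ Γ →+ ZMod (2 * P)}
    (hF : IsTiltedFrame (unit Γ) i j θ P v) :
    θ = mirror (le_comap_swapHom hF.ne (nsmul_diff_mem_of_isTiltedFrame hF)
      (fun _ hγ => dvd_diff_of_isTiltedFrame hF hγ)) ∧
      v = diagHeight P (fun _ hγ => dvd_diff_of_isTiltedFrame hF hγ) := by
  have hF' := isTiltedFrame hF.ne hF.two_le (nsmul_diff_mem_of_isTiltedFrame hF)
    (fun _ hγ => dvd_diff_of_isTiltedFrame hF hγ)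
  refine ⟨addMonoidHom_ext Γ fun m => ?_, addMonoidHom_ext Γ fun m => ?_⟩
  · rw [hF.map_e, hF'.map_e]
  · by_cases hmi : m = i
    · subst hmi
      rw [hF.height_left, hF'.height_left]
    · by_cases hmj : m = j
      · subst hmj
        rw [hF.height_right, hF'.height_right]
      · rw [hF.height_other m hmi hmj, hF'.height_other m hmi hmj]

end Tilted

end PeriodicBox

end TiltedRP

end Summit.QuantumFields.GaugeBoot
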